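/-
Copyright (c) 2026. All rights reserved.
Released under Apache 2.0 license as described in the file LICENSE.
-/
import Literature.AlgebraicGeometry.Motives.HodgeStructureCentralizerBlockwiseCharpoly
import Literature.NumberTheory.GaloisRepresentations.CoefficientEigenspaces
import Mathlib.LinearAlgebra.Charpoly.ToMatrix
import HarnessLib

/-!
# One Frobenius orbit of eigenspaces: `charpoly (φ^f) = charpoly (φ^f | D_μ)^f`

Abstract linear algebra behind the last proof-side rung of the D2-cris repair
(`SoloInformedRepairD2Cris.lean` §4, clause `CrystallineCompatibleAt`: `charpoly (φ_D^{f}) = P^{f}` on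
`D_cris(ρ|Γ_{K_v})`, `q_v = p^f`); the specialization to `D_cris(ρ_v)` is `…D2CrisCharpoly`.

Setting: a field `E`, a finite-dimensional `E`-space `V`, `M, φ ∈ End_E V`, an injective `e : Fin f → E` with
`(e i)^p = e (i+1)` (indices mod `f`) such that `∏ᵢ (X - e i)` annihilates `M`, and the semilinearity relations
`φ M = M^p φ`, `φ^f M = M φ^f` (on `D_cris`: `M = M_a` the Teichmüller `K₀`-generator, `e i = c^{p^i}` the
Frobenius orbit of one eigenvalue, `φ = φ_D`).  Then

* `V = ⊕ᵢ D_{e i}`, `D_μ` the `μ`-eigenspace of `M` (`isInternal_eigenspace`); `φ (D_{e(i+1)}) ⊆ D_{e i}`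
  (`mapsTo_eigenspace_succ`: `(M - e i)(φ x)` is killed by the coprime `X^p - e(i+1)` and `∏_{j≠i} (X - e j)`);
  `φ^f` preserves every `D_μ` (`mapsTo_eigenspace_of_comp_eq`);
* if `φ` is injective: the cyclic chain `dim D_{e(i+1)} ≤ dim D_{e i}` around `ℤ/f` forces equality
  (`finrank_eigenspace_succ`), `φ | D_{e(i+1)}` is an isomorphism onto `D_{e i}` conjugating `φ^f | D_{e(i+1)}`
  into `φ^f | D_{e i}` (`charpoly_restrict_succ`), hence **`charpoly (φ^f) = charpoly (φ^f | D_{e i})^f`** and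
  **`dim V = f · dim D_{e i}`** (`charpoly_pow_eq_pow_charpoly_restrict`, `finrank_eq_mul_finrank_eigenspace`).

Elementary index bookkeeping on `Fin f` (`[NeZero f]`, successor `i ↦ i + 1`) and on Frobenius orbits
`i ↦ c^{q^i}` is proved here too.  Everything is unconditional and `sorry`-free; no new objects.

References: Fontaine, *Le corps des périodes p-adiques*, Astérisque 223 (1994), Exp. VIII §2.3.7 (the
`τ`-decomposition of a filtered `φ`-module with coefficients); Horn–Johnson, *Matrix Analysis* (2013), §0.9.2,
§1.3 (block-diagonal characteristic polynomials, similarity invariance).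
-/

noncomputable section

open scoped Polynomial
open Polynomial
open Literature.NumberTheory.GaloisRepresentations

namespace Summit.Langlands.Langlands.Theorems

namespace D2Cris

/-! ### §1 One Frobenius orbit of eigenspaces: `charpoly (φ^f) = charpoly (φ^f | D_{e i})^f` -/

section Cyclic

/-- `c^{q^n} = c ⇒ c^{q^{n k}} = c`. [folklore] -/
theorem pow_pow_mul_eq_self {R : Type*} [Monoid R] {c : R} {q n : ℕ} (hc : c ^ q ^ n = c) (k : ℕ) :
    c ^ q ^ (n * k) = c := by
  induction k with
  | zero => rw [mul_zero, pow_zero, pow_one]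
  | succ k ih => rw [Nat.mul_succ, pow_add, pow_mul, ih, hc]

/-- `c^{q^n} = c ⇒ c^{q^{k mod n}} = c^{q^k}`. [folklore] -/
theorem pow_pow_mod_eq {R : Type*} [Monoid R] {c : R} {q n : ℕ} (hc : c ^ q ^ n = c) (k : ℕ) :
    c ^ q ^ (k % n) = c ^ q ^ k := by
  conv_rhs => rw [← Nat.div_add_mod k n, pow_add, pow_mul, pow_pow_mul_eq_self hc]

variable {f : ℕ}

/-- `↑(i + 1) = (↑i + 1) mod f` in `Fin f`. [folklore] -/
theorem fin_val_add_one [NeZero f] (i : Fin f) : ((i + 1 : Fin f) : ℕ) = ((i : ℕ) + 1) % f := by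
  rw [Fin.val_add, Fin.val_one', Nat.add_mod_mod]

/-- `⟨k, _⟩ + 1 = ⟨k + 1, _⟩` in `Fin f` below the wrap-around. [folklore] -/
theorem fin_mk_add_one [NeZero f] {k : ℕ} (hk : k + 1 < f) :
    (⟨k, (Nat.lt_succ_self k).trans hk⟩ + 1 : Fin f) = ⟨k + 1, hk⟩ :=
  Fin.ext (by rw [fin_val_add_one, Nat.mod_eq_of_lt hk])

/-- A function on `Fin f` invariant under `i ↦ i + 1` is constant (`= g 0`). [folklore] -/
theorem apply_eq_apply_zero_of_forall_succ [NeZero f] {α : Type*} {g : Fin f → α}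
    (hg : ∀ i, g (i + 1) = g i) (i : Fin f) : g i = g 0 := by
  obtain ⟨k, hk⟩ := i
  induction k with
  | zero => exact congrArg g (Fin.ext (Fin.val_zero f).symm)
  | succ k ih => rw [← ih ((Nat.lt_succ_self k).trans hk), ← fin_mk_add_one hk, hg]

/-- **The Frobenius orbit `i ↦ c^{q^i}` (`i < f`) is injective** when `c^{q^f} = c` and `c^{q^k} ≠ c` for
`0 < k < f`. [folklore] -/
theorem injective_pow_pow {R : Type*} [Monoid R] {c : R} {q : ℕ} (hcf : c ^ q ^ f = c)
    (hne : ∀ k, 0 < k → k < f → c ^ q ^ k ≠ c) :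
    Function.Injective fun i : Fin f => c ^ q ^ (i : ℕ) := by
  have aux : ∀ i j : Fin f, (i : ℕ) < j → c ^ q ^ (i : ℕ) = c ^ q ^ (j : ℕ) → False := by
    intro i j hij h
    have hjf := j.2
    refine hne (i + (f - j)) (by omega) (by omega) ?_
    have h1 : c ^ q ^ ((j : ℕ) + (f - j)) = c := by rw [Nat.add_sub_cancel' hjf.le, hcf]
    calc c ^ q ^ ((i : ℕ) + (f - j)) = (c ^ q ^ (i : ℕ)) ^ q ^ (f - j) := by rw [pow_add, pow_mul]
      _ = (c ^ q ^ (j : ℕ)) ^ q ^ (f - j) := by rw [h]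
      _ = c := by rw [← pow_mul, ← pow_add, h1]
  intro i j h
  rcases lt_trichotomy (i : ℕ) j with hlt | heq | hgt
  · exact (aux i j hlt h).elim
  · exact Fin.ext heq
  · exact (aux j i hgt h.symm).elim

/-- `(c^{q^i})^q = c^{q^{i+1}}` along the orbit (indices mod `f`, using `c^{q^f} = c`). [folklore] -/
theorem pow_pow_fin_succ [NeZero f] {R : Type*} [Monoid R] {c : R} {q : ℕ} (hcf : c ^ q ^ f = c) (i : Fin f) :
    (c ^ q ^ (i : ℕ)) ^ q = c ^ q ^ ((i + 1 : Fin f) : ℕ) := by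
  rw [fin_val_add_one, pow_pow_mod_eq hcf, pow_succ, pow_mul]

variable {E : Type*} [Field E] {V : Type*} [AddCommGroup V] [Module E V] {p : ℕ}
  {M φ : Module.End E V} {e : Fin f → E}

/-- An endomorphism commuting with `M` preserves the eigenspaces of `M`. [folklore] -/
theorem mapsTo_eigenspace_of_comp_eq {g : Module.End E V} (hg : g ∘ₗ M = M ∘ₗ g) (μ : E) :
    Set.MapsTo (g : V → V) (M.eigenspace μ) (M.eigenspace μ) := fun x hx => by
  rw [SetLike.mem_coe, Module.End.mem_eigenspace_iff] at hx ⊢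
  have h := LinearMap.congr_fun hg x
  simp only [LinearMap.comp_apply] at h
  rw [← h, hx, map_smul]

/-- **`φ (D_{e(i+1)}) ⊆ D_{e i}`**: if `φ M = M^p φ`, `(e i)^p = e (i+1)`, the `e j` are distinct and
`∏ⱼ (X - e j)` annihilates `M`, then `φ` carries the `e (i+1)`-eigenspace of `M` into the `e i`-eigenspace
(`y = φ x` satisfies `M^p y = e(i+1) y`; `(M - e i) y` is killed by the coprime polynomials `X^p - e(i+1)` and
`∏_{j ≠ i} (X - e j)`). [cite: FontaineAsterisque223VIII, §2.3.7] -/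
theorem mapsTo_eigenspace_succ [NeZero f] (he : Function.Injective e) (hpow : ∀ i, e i ^ p = e (i + 1))
    (hann : aeval M (∏ i, (X - C (e i))) = 0) (hMφ : φ ∘ₗ M = (M ^ p) ∘ₗ φ) (i : Fin f) :
    Set.MapsTo (φ : V → V) (M.eigenspace (e (i + 1))) (M.eigenspace (e i)) := by
  classical
  intro x hx
  rw [SetLike.mem_coe, Module.End.mem_eigenspace_iff] at hx ⊢
  have hy : aeval M (X ^ p - C (e (i + 1))) (φ x) = 0 := by
    have h := LinearMap.congr_fun hMφ x
    simp only [LinearMap.comp_apply] at h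
    rw [map_sub, aeval_X_pow, aeval_C, LinearMap.sub_apply, Module.algebraMap_end_apply, ← h, hx, map_smul,
      sub_self]
  have hz : aeval M (X - C (e i)) (φ x) = M (φ x) - e i • φ x := by
    rw [map_sub, aeval_X, aeval_C, LinearMap.sub_apply, Module.algebraMap_end_apply]
  have hz1 : aeval M (X - C (e i)) (φ x) ∈ LinearMap.ker (aeval M (X ^ p - C (e (i + 1)))) := by
    rw [LinearMap.mem_ker, ← Module.End.mul_apply, ← map_mul, mul_comm, map_mul, Module.End.mul_apply, hy,
      map_zero]
  have hz2 : aeval M (X - C (e i)) (φ x) ∈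
      LinearMap.ker (aeval M (∏ j ∈ Finset.univ.erase i, (X - C (e j)))) := by
    rw [LinearMap.mem_ker, ← Module.End.mul_apply, ← map_mul, Finset.prod_erase_mul _ _ (Finset.mem_univ i),
      hann, LinearMap.zero_apply]
  have hcop : IsCoprime (X ^ p - C (e (i + 1))) (∏ j ∈ Finset.univ.erase i, (X - C (e j))) := by
    refine IsCoprime.prod_right fun j hj =>
      (((Polynomial.irreducible_X_sub_C (e j)).coprime_iff_not_dvd).2 fun hdvd => ?_).symm
    rw [Polynomial.dvd_iff_isRoot, Polynomial.IsRoot.def, eval_sub, eval_pow, eval_X, eval_C, sub_eq_zero,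
      hpow] at hdvd
    exact Finset.ne_of_mem_erase hj (add_right_cancel (he hdvd))
  have hdis := Polynomial.disjoint_ker_aeval_of_isCoprime M hcop
  rw [disjoint_iff] at hdis
  have hz0 : aeval M (X - C (e i)) (φ x) ∈
      LinearMap.ker (aeval M (X ^ p - C (e (i + 1)))) ⊓
        LinearMap.ker (aeval M (∏ j ∈ Finset.univ.erase i, (X - C (e j)))) := ⟨hz1, hz2⟩
  rw [hdis, Submodule.mem_bot, hz, sub_eq_zero] at hz0
  exact hz0

/-- **`V = ⊕ᵢ D_{e i}`** when the `e i` are distinct and `∏ᵢ (X - e i)` annihilates `M`. [cite: HornJohnson2013, §1.3] -/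
theorem isInternal_eigenspace (he : Function.Injective e)
    (hann : aeval M (∏ i, (X - C (e i))) = 0) :
    DirectSum.IsInternal fun i => M.eigenspace (e i) := by
  classical
  refine DirectSum.isInternal_submodule_of_iSupIndep_of_iSup_eq_top
    ((Module.End.eigenspaces_iSupIndep M).comp he) ?_
  have hprod : (∏ r ∈ Finset.univ.image e, (X - C r)) = ∏ i, (X - C (e i)) := by
    rw [Finset.prod_image fun i _ j _ h => he h]
  have htop : (⨆ r ∈ Finset.univ.image e, LinearMap.ker (aeval M (X - C r))) = ⊤ := by
    rw [CoeffEigen.iSup_ker_aeval_X_sub_C, hprod, hann, LinearMap.ker_zero]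
  refine top_le_iff.1 (htop.symm.le.trans (iSup₂_le fun r hr => ?_))
  obtain ⟨i, -, rfl⟩ := Finset.mem_image.1 hr
  rw [CoeffEigen.ker_aeval_X_sub_C]
  exact le_iSup (fun i => M.eigenspace (e i)) i

section Injective

variable [NeZero f] [FiniteDimensional E V] (he : Function.Injective e) (hpow : ∀ i, e i ^ p = e (i + 1))
  (hann : aeval M (∏ i, (X - C (e i))) = 0) (hMφ : φ ∘ₗ M = (M ^ p) ∘ₗ φ)
  (hMφf : (φ ^ f) ∘ₗ M = M ∘ₗ (φ ^ f)) (hφ : Function.Injective φ)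

omit [FiniteDimensional E V] in
include he hpow hann hMφ hφ in
/-- `φ | D_{e(i+1)} : D_{e(i+1)} → D_{e i}` is injective when `φ` is. [folklore] -/
theorem restrict_succ_injective (i : Fin f) :
    Function.Injective (φ.restrict (mapsTo_eigenspace_succ he hpow hann hMφ i)) := fun x y hxy =>
  Subtype.ext (hφ (by simpa only [LinearMap.coe_restrict_apply] using congrArg Subtype.val hxy))

include he hpow hann hMφ hφ in
/-- `dim D_{e(i+1)} ≤ dim D_{e i}` (injective `φ`). [folklore] -/
theorem finrank_eigenspace_succ_le (i : Fin f) :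
    Module.finrank E (M.eigenspace (e (i + 1))) ≤ Module.finrank E (M.eigenspace (e i)) :=
  LinearMap.finrank_le_finrank_of_injective (restrict_succ_injective he hpow hann hMφ hφ i)

include he hpow hann hMφ hφ in
/-- **All eigenspaces of the orbit have the same dimension**: `dim D_{e(i+1)} = dim D_{e i}` — the cyclic chain
of inequalities `dim D_{e(i+1)} ≤ dim D_{e i}` around `ℤ/f` closes up. [cite: FontaineAsterisque223VIII, §2.3.7] -/
theorem finrank_eigenspace_succ (i : Fin f) :
    Module.finrank E (M.eigenspace (e (i + 1))) = Module.finrank E (M.eigenspace (e i)) := by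
  have hle : ∀ j ∈ (Finset.univ : Finset (Fin f)),
      (fun j => Module.finrank E (M.eigenspace (e (j + 1)))) j ≤
        (fun j => Module.finrank E (M.eigenspace (e j))) j :=
    fun j _ => finrank_eigenspace_succ_le he hpow hann hMφ hφ j
  have hsum : ∑ j, (fun j : Fin f => Module.finrank E (M.eigenspace (e (j + 1)))) j =
      ∑ j, (fun j => Module.finrank E (M.eigenspace (e j))) j :=
    Equiv.sum_comp (Equiv.addRight (1 : Fin f)) fun j => Module.finrank E (M.eigenspace (e j))
  exact (Finset.sum_eq_sum_iff_of_le hle).1 hsum i (Finset.mem_univ i)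

include he hpow hann hMφ hφ in
/-- **`φ` conjugates `φ^f | D_{e(i+1)}` into `φ^f | D_{e i}`**, so the two restrictions have the same
characteristic polynomial. [cite: FontaineAsterisque223VIII, §2.3.7] -/
theorem charpoly_restrict_succ (i : Fin f) :
    ((φ ^ f).restrict (mapsTo_eigenspace_of_comp_eq hMφf (e (i + 1)))).charpoly =
      ((φ ^ f).restrict (mapsTo_eigenspace_of_comp_eq hMφf (e i))).charpoly := by
  have hinj := restrict_succ_injective he hpow hann hMφ hφ i
  let u : M.eigenspace (e (i + 1)) ≃ₗ[E] M.eigenspace (e i) :=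
    LinearEquiv.ofBijective (φ.restrict (mapsTo_eigenspace_succ he hpow hann hMφ i))
      ⟨hinj, (LinearMap.injective_iff_surjective_of_finrank_eq_finrank
        (finrank_eigenspace_succ he hpow hann hMφ hφ i)).1 hinj⟩
  have hconj : u.conj ((φ ^ f).restrict (mapsTo_eigenspace_of_comp_eq hMφf (e (i + 1)))) =
      (φ ^ f).restrict (mapsTo_eigenspace_of_comp_eq hMφf (e i)) := by
    refine LinearMap.ext fun y => ?_
    obtain ⟨x, rfl⟩ := u.surjective y
    rw [LinearEquiv.conj_apply, LinearMap.comp_apply, LinearMap.comp_apply, LinearEquiv.coe_coe,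
      LinearEquiv.coe_coe, LinearEquiv.symm_apply_apply]
    refine Subtype.ext ?_
    simp only [u, LinearEquiv.ofBijective_apply, LinearMap.coe_restrict_apply]
    rw [← Module.End.mul_apply, ← Module.End.mul_apply, ← pow_succ, ← pow_succ']
  rw [← hconj, LinearEquiv.charpoly_conj]

include he hpow hann hMφ hMφf hφ in
/-- **`charpoly (φ^f) = charpoly (φ^f | D_μ)^f`** for any member `μ = e i` of the orbit. [cite: FontaineAsterisque223VIII, §2.3.7] -/
theorem charpoly_pow_eq_pow_charpoly_restrict {μ : E} (hμ : ∃ i, e i = μ)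
    (h : Set.MapsTo ((φ ^ f : Module.End E V) : V → V) (M.eigenspace μ) (M.eigenspace μ)) :
    (φ ^ f).charpoly = ((φ ^ f).restrict h).charpoly ^ f := by
  classical
  obtain ⟨i, rfl⟩ := hμ
  rw [Literature.AlgebraicGeometry.Motives.charpoly_eq_prod_charpoly_restrict_of_isInternal E
    (isInternal_eigenspace he hann) (fun j => mapsTo_eigenspace_of_comp_eq hMφf (e j))]
  have hall : ∀ j, ((φ ^ f).restrict (mapsTo_eigenspace_of_comp_eq hMφf (e j))).charpoly =
      ((φ ^ f).restrict (mapsTo_eigenspace_of_comp_eq hMφf (e i))).charpoly := fun j => by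
    rw [apply_eq_apply_zero_of_forall_succ
        (g := fun j => ((φ ^ f).restrict (mapsTo_eigenspace_of_comp_eq hMφf (e j))).charpoly)
        (charpoly_restrict_succ he hpow hann hMφ hMφf hφ) j,
      apply_eq_apply_zero_of_forall_succ
        (g := fun j => ((φ ^ f).restrict (mapsTo_eigenspace_of_comp_eq hMφf (e j))).charpoly)
        (charpoly_restrict_succ he hpow hann hMφ hMφf hφ) i]
  rw [Finset.prod_congr rfl fun j _ => hall j, Finset.prod_const, Finset.card_univ, Fintype.card_fin]

include he hpow hann hMφ hMφf hφ in
/-- **`dim V = f · dim D_μ`** for any member `μ` of the orbit. [cite: FontaineAsterisque223VIII, §2.3.7] -/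
theorem finrank_eq_mul_finrank_eigenspace {μ : E} (hμ : ∃ i, e i = μ) :
    Module.finrank E V = f * Module.finrank E (M.eigenspace μ) := by
  have h := congrArg Polynomial.natDegree
    (charpoly_pow_eq_pow_charpoly_restrict he hpow hann hMφ hMφf hφ hμ (mapsTo_eigenspace_of_comp_eq hMφf μ))
  rwa [LinearMap.charpoly_natDegree, Polynomial.natDegree_pow, LinearMap.charpoly_natDegree] at h

end Injective

end Cyclic

end D2Cris

end Summit.Langlands.Langlands.Theorems
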